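import Summits.QuantumFields.BalabanUV.T4Continuum.Support.VariationalVectorGaugeSliceDist
import Summits.QuantumFields.BalabanUV.T4Continuum.Support.VariationalVectorAvgGDecomposition
import Summits.QuantumFields.BalabanUV.T4Continuum.Support.VariationalVectorOneStep
import Summits.QuantumFields.BalabanUV.T4Continuum.Support.VariationalColourScalarPair

/-!
# T⁴ programme, spine node NE2 (U1a), lane P2 — «V-ONE-G SUMMABLE», file A: THREE LATTICE INEQUALITIES FOR THE RAW SIZES OF (ONE-min) WITH BACKGROUND —
# the diagonal first differences are part of the rough form, the covariant gradient OF THE DIVERGENCE is below `2d·hessV + 2d²p²·‖W‖²`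
# (one plaquette commutator), and the gradient of the HARMONIC PART `Π_{S_R(K)ᗮ}(div_R W)` is below `Λ_s·n⁻²·divSq` (scalar UB + Jensen)
# (model level; cell `pub-balaban`)

NE2 formalisation swarm `b2b-balaban-t4-ne2-formalise-*`, leaf prover 01 GEN 9 (`prover-b2b-balaban-t4-ne2-formalise-leaf-01-g9-0`); journal INTENT
«V-ONE-G SUMMABLE» CLAIMS.log 2026-08-20 l.20284.  On top of leaf-02-g4's colour Bochner calculus `VariationalColourBochner` (p215065: `Dirv`, `DirAdjv`,
`Dirv_DirAdjv_comm`, `norm_kappa1v_le`, `nsqv_DirAdjv_eq`, `sum_sq_translate`), `VariationalVectorWeitzenbock` (`divV`, `divSq`, `nsqV_eq_sum_nsqv`),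
`VariationalVectorOneStep` (`hessV`), gen 8's `VariationalVectorGaugeSliceDist` (`isMin_starProjection_orthogonal`: the orthogonal representative IS a scalar
fibre-minimiser) and leaf-10-g4's Jensen `VariationalVectorAvgGDecomposition.sum_norm_sq_Qcv_le`, all BY NAME; nothing defined.

WHY.  Gen 8's assembled (ONE-min) with background for the componentwise centred competitor `J_c` (`VariationalVectorOneMinCentred.hONEm_centred` ∕
`oneG_centred_le`, p233079) carries EXPLICIT raw sizes at the coarse minimiser `W₀`: `hessV W₀`, `Σ_μ‖D_μW_μ‖²`, `Σ‖D(div W₀)‖²`, `Σ‖D(div W₀ − s₀)‖²`,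
`divSq W₀`, `nsqV W₀`.  For the monotone END's summable `hONEm_k` these must be read in the currency of the displayed leaves V-REG (`rhoV = n⁴∕n^d·hessV`),
(Går) (`n^{2−d}·roughV`), div-control (`n^{2−d}·divSq`), V-P (`qWV`).  This file supplies the three lattice facts that are not bookkeeping:
 * §1 **`sum_diag_le_roughV`**: `Σ_μ Σ_y ‖D_μW_μ(y)‖² ≤ roughV n M R W` (the diagonal is part of the rough form).
 * §2 **`sum_cDv_divV_sq_le`**: for UNITARY bond transports with plaquette defect `≤ p` (operator norm),
   `Σ_{y,κ} ‖D_κ(div_R W)(y)‖² ≤ 2d·hessV R W + 2d²p²·nsqV W` — `D_κ D_μ† = D_μ† D_κ + κ₁` with `‖κ₁‖ ≤ p` (`Dirv_DirAdjv_comm`, `norm_kappa1v_le`),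
   `‖D_μ†g‖_{ℓ²} = ‖D_μg‖_{ℓ²}` (`nsqv_DirAdjv_eq`), Cauchy–Schwarz over the `d` components; any torus `Tor N`.
 * §3 **`sum_dirUv_harmonicPart_le`**: for contractive site frames `T`, the scalar UB leaf `hUBc` (constant `Λ`) and ANY 0-form `v`, the orthogonal
   representative `s₀ := Π_{(S_R(ker Q_T))ᗮ} v` satisfies `Σ_μ dirUv R s₀ μ ≤ Λ·(n²)⁻¹·Σ_x‖v x‖²` (`s₀` minimises the scalar Dirichlet sum on its fibre, the UB
   competitor bounds it by `Λ·nsqv(Q_T s₀)`, Jensen gives `nsqv(Q_T s₀) ≤ n^{−d}·nsqv s₀`, and `‖s₀‖ ≤ ‖v‖`); **`sum_cDv_sub_harmonicPart_sq_le`**: with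
   `v := div_R W`, `Σ_{y,μ}‖D_μ(div_R W − s₀)(y)‖² ≤ 2·(2d·hessV R W + 2d²p²·nsqV W) + 2·Λ·(n²)⁻¹·divSq R W` — the `S0` summand of `oneG_centred_le`.
 * §4 **`rhoTilde_abstract_le`**: the pure-real arithmetic of file B's assembly (gen 8's `ρ̃` as a polynomial in the raw sizes; budgets
   `size ≤ coefficient·A` and the normalisations `cf·L^d∕L² = cc`, `cf·L^{d−1} = cc·L`, `cf·L^d = cc·L²` give `ρ̃ ≤ ε⋆·A`).
File B (`VariationalVectorOneMinCentredReg`) turns these into `ρ̃ W₀ ≤ ε⋆·(ScV W₀ + nsqV φ)` at vector minimisers.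

HONEST FRAMING (T4-DAG p. 1).  Lattice calculus at MODEL level (transports ∕ frames DATA, c5); [folklore]; nothing printed is a hypothesis; no `def`, no
`def … : Prop`, no `sorry`; axioms standard.  Nothing with background is discharged here; V-END with background ∕ NE2 NOT proved; NE3 OPEN; spine PROVED 0∕9
unchanged; rung (B)+1 on a fixed finite T⁴ — NOT infinite volume, NOT mass gap, NOT Clay.  HONEST DEPENDENCY (cell, verbatim): continuum YM on T⁴ ⇐ BetaPertH ∧
nine spine estimates (0/9 proved); BetaPertH ⇐ (D1) ∧ (D4) ∧ CAP+tail; G-an2-4 gates asym, D1 and NE2/3/4.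
-/

noncomputable section

namespace Summit.QuantumFields.BalabanUV.T4Continuum.VariationalVectorDivHessian

open Finset WithLp
open scoped InnerProductSpace
open Literature.MathematicalPhysics.QuantumFieldTheory.Balaban1983to89.B5Prop11Plancherel (Tor fine unitVec)
open Summit.QuantumFields.BalabanUV.T4Continuum.VariationalColourFederbush (cDv dirUv Qcv)
open Summit.QuantumFields.BalabanUV.T4Continuum.VariationalColourBochner
  (Dirv DirAdjv Dirv_sum Dirv_DirAdjv_comm norm_kappa1v_le nsqv_DirAdjv_eq sum_sq_translate)
open Summit.QuantumFields.BalabanUV.T4Continuum.VariationalCovariantFederbush (sq_sum_le_card_mul)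
open Summit.QuantumFields.BalabanUV.T4Continuum.VariationalColourUpperBound (nsqv)
open Summit.QuantumFields.BalabanUV.T4Continuum.VariationalColourScalarPair (Scv Qkv)
open Summit.QuantumFields.BalabanUV.T4Continuum.VectorBlockTrialForm (nsqV roughV)
open Summit.QuantumFields.BalabanUV.T4Continuum.VariationalVectorForm (norm_sub_sq_le_two)
open Summit.QuantumFields.BalabanUV.T4Continuum.VariationalVectorWeitzenbock (divV divSq nsqV_eq_sum_nsqv)
open Summit.QuantumFields.BalabanUV.T4Continuum.VariationalVectorGaugeSlice (sliceSub avgOp norm_toLp_sq)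
open Summit.QuantumFields.BalabanUV.T4Continuum.VariationalVectorGaugeSliceDist (isMin_starProjection_orthogonal)
open Summit.QuantumFields.BalabanUV.T4Continuum.VariationalVectorAvgGDecomposition (sum_norm_sq_Qcv_le)
open Summit.QuantumFields.BalabanUV.T4Continuum.VariationalVectorOneStep (hessV cDv_sub)

variable {d : ℕ} {E : Type*} [NormedAddCommGroup E] [InnerProductSpace ℂ E] [CompleteSpace E]

/-! ## §1 The diagonal first differences are part of the rough form -/

section Diag

variable (n : ℕ) [NeZero n] (M : Fin d → ℕ) [hM : ∀ μ, NeZero (M μ)]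

omit [CompleteSpace E] in
/-- **`Σ_μ Σ_y ‖D_μW_μ(y)‖² ≤ roughV n M R W`** — the diagonal `ν = μ` summands of leaf-03-g4's rough form `Σ_{ν,μ,x}‖R(x,ν)W(x+e_ν,μ) − W(x,μ)‖²`. [folklore] -/
theorem sum_diag_le_roughV (R : Tor (fine n M) → Fin d → (E →L[ℂ] E)) (W : Tor (fine n M) → Fin d → E) :
    ∑ μ, ∑ y, ‖cDv (fine n M) R (fun z => W z μ) y μ‖ ^ 2 ≤ roughV n M R W := by
  unfold roughV cDv
  refine sum_le_sum fun μ _ => ?_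
  exact single_le_sum (f := fun ν => ∑ x, ‖R x μ (W (x + unitVec (fine n M) μ) ν) - W x ν‖ ^ 2)
    (fun ν _ => sum_nonneg fun x _ => by positivity) (mem_univ μ)

omit [CompleteSpace E] in
/-- the same with the site sum outside: `Σ_y Σ_μ ‖D_μW_μ(y)‖² ≤ roughV n M R W` (the order of gen 8's fibre-defect size `B`). [folklore] -/
theorem sum_diag_le_roughV' (R : Tor (fine n M) → Fin d → (E →L[ℂ] E)) (W : Tor (fine n M) → Fin d → E) :
    ∑ y, ∑ μ, ‖cDv (fine n M) R (fun z => W z μ) y μ‖ ^ 2 ≤ roughV n M R W := by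
  rw [Finset.sum_comm]; exact sum_diag_le_roughV n M R W

end Diag

/-! ## §2 The covariant gradient of the divergence: one plaquette commutator -/

section DivGrad

variable (N : Fin d → ℕ) [∀ μ, NeZero (N μ)]

omit [∀ μ, NeZero (N μ)] in
/-- the divergence as a field is the sum of the adjoint differences of the components. [folklore] -/
theorem divV_eq_sum (R : Tor N → Fin d → (E →L[ℂ] E)) (W : Tor N → Fin d → E) :
    divV N R W = fun x => ∑ μ ∈ univ, DirAdjv N R μ (fun y => W y μ) x := rfl

omit [∀ μ, NeZero (N μ)] in
/-- pointwise: `‖D_κ(div_R W)(y)‖ ≤ Σ_μ (‖(D_μ† D_κ W_μ)(y)‖ + p·‖W_μ(y − e_μ + e_κ)‖)` for UNITARY transports with plaquette defect `≤ p`. [folklore] -/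
theorem norm_cDv_divV_le {R : Tor N → Fin d → (E →L[ℂ] E)} (hU : ∀ x μ, R x μ ∈ unitary (E →L[ℂ] E)) {p : ℝ}
    (hP : ∀ x μ ν, ‖R x μ * R (x + unitVec N μ) ν - R x ν * R (x + unitVec N ν) μ‖ ≤ p) (W : Tor N → Fin d → E) (y : Tor N) (κ : Fin d) :
    ‖cDv N R (divV N R W) y κ‖
      ≤ ∑ μ, (‖DirAdjv N R μ (Dirv N R κ (fun z => W z μ)) y‖ + p * ‖W (y - unitVec N μ + unitVec N κ) μ‖) := by
  have h1 : cDv N R (divV N R W) y κ = ∑ μ, Dirv N R κ (DirAdjv N R μ (fun z => W z μ)) y := by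
    rw [divV_eq_sum]; exact Dirv_sum N R κ univ _ y
  rw [h1]
  refine (norm_sum_le _ _).trans (sum_le_sum fun μ _ => ?_)
  have hc := Dirv_DirAdjv_comm N R μ κ (fun z => W z μ) y
  have e : Dirv N R κ (DirAdjv N R μ (fun z => W z μ)) y
      = DirAdjv N R μ (Dirv N R κ (fun z => W z μ)) y
        + (R y κ * star (R (y - unitVec N μ + unitVec N κ) μ) - star (R (y - unitVec N μ) μ) * R (y - unitVec N μ) κ)
            (W (y - unitVec N μ + unitVec N κ) μ) := by
    rw [← hc]; abel
  rw [e]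
  refine (norm_add_le _ _).trans (add_le_add le_rfl ?_)
  exact (ContinuousLinearMap.le_opNorm _ _).trans (mul_le_mul_of_nonneg_right (norm_kappa1v_le N hU hP μ κ y) (norm_nonneg _))

omit [CompleteSpace E] in
/-- the mixed second differences `Σ_{κ,μ} ‖D_μ D_κ W_μ‖²_{ℓ²}` are part of the full Hessian `hessV`. [folklore] -/
theorem sum_nsqv_Dirv_Dirv_le_hessV (R : Tor N → Fin d → (E →L[ℂ] E)) (W : Tor N → Fin d → E) :
    ∑ κ, ∑ μ, VariationalColourBochner.nsqv N (Dirv N R μ (Dirv N R κ (fun z => W z μ))) ≤ hessV N R W := by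
  rw [Finset.sum_comm]
  unfold hessV VariationalColourInterpolant.hessv
  refine sum_le_sum fun μ _ => ?_
  have h := single_le_sum (f := fun a => ∑ b, dirUv N R (fun z => cDv N R (fun z => W z μ) z b) a)
    (fun a _ => sum_nonneg fun b _ => VariationalColourFederbush.dirUv_nonneg N R _ _) (mem_univ μ)
  refine le_trans (le_of_eq ?_) h
  rfl

/-- **THE COVARIANT GRADIENT OF THE DIVERGENCE**: for UNITARY bond transports with plaquette defect `≤ p` in operator norm and every 1-form `W`,
`Σ_{y,κ} ‖D_κ(div_R W)(y)‖² ≤ 2d·hessV R W + 2d²p²·nsqV W`. [folklore] -/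
theorem sum_cDv_divV_sq_le {R : Tor N → Fin d → (E →L[ℂ] E)} (hU : ∀ x μ, R x μ ∈ unitary (E →L[ℂ] E)) {p : ℝ} (hp : 0 ≤ p)
    (hP : ∀ x μ ν, ‖R x μ * R (x + unitVec N μ) ν - R x ν * R (x + unitVec N ν) μ‖ ≤ p) (W : Tor N → Fin d → E) :
    ∑ y, ∑ κ, ‖cDv N R (divV N R W) y κ‖ ^ 2 ≤ 2 * d * hessV N R W + 2 * (d : ℝ) ^ 2 * p ^ 2 * nsqV N W := by
  -- pointwise square bound by Cauchy–Schwarz over the `d` components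
  have hpt : ∀ y κ, ‖cDv N R (divV N R W) y κ‖ ^ 2
      ≤ 2 * d * ∑ μ, ‖DirAdjv N R μ (Dirv N R κ (fun z => W z μ)) y‖ ^ 2 + 2 * d * p ^ 2 * ∑ μ, ‖W (y - unitVec N μ + unitVec N κ) μ‖ ^ 2 := by
    intro y κ
    have h0 : 0 ≤ ∑ μ, (‖DirAdjv N R μ (Dirv N R κ (fun z => W z μ)) y‖ + p * ‖W (y - unitVec N μ + unitVec N κ) μ‖) :=
      sum_nonneg fun μ _ => by positivity
    calc ‖cDv N R (divV N R W) y κ‖ ^ 2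
        ≤ (∑ μ, (‖DirAdjv N R μ (Dirv N R κ (fun z => W z μ)) y‖ + p * ‖W (y - unitVec N μ + unitVec N κ) μ‖)) ^ 2 :=
          pow_le_pow_left₀ (norm_nonneg _) (norm_cDv_divV_le N hU hP W y κ) 2
      _ ≤ (univ : Finset (Fin d)).card * ∑ μ, (‖DirAdjv N R μ (Dirv N R κ (fun z => W z μ)) y‖ + p * ‖W (y - unitVec N μ + unitVec N κ) μ‖) ^ 2 :=
          sq_sum_le_card_mul _ _
      _ ≤ d * ∑ μ, (2 * ‖DirAdjv N R μ (Dirv N R κ (fun z => W z μ)) y‖ ^ 2 + 2 * (p * ‖W (y - unitVec N μ + unitVec N κ) μ‖) ^ 2) := by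
          rw [card_univ, Fintype.card_fin]
          refine mul_le_mul_of_nonneg_left (sum_le_sum fun μ _ => ?_) (Nat.cast_nonneg d)
          nlinarith [sq_nonneg (‖DirAdjv N R μ (Dirv N R κ (fun z => W z μ)) y‖ - p * ‖W (y - unitVec N μ + unitVec N κ) μ‖)]
      _ = _ := by rw [sum_add_distrib, ← mul_sum, ← mul_sum]; simp only [mul_pow]; rw [← mul_sum]; ring
  -- sum over `y, κ`
  have hA : ∑ y, ∑ κ, ∑ μ, ‖DirAdjv N R μ (Dirv N R κ (fun z => W z μ)) y‖ ^ 2 ≤ hessV N R W := by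
    calc ∑ y, ∑ κ, ∑ μ, ‖DirAdjv N R μ (Dirv N R κ (fun z => W z μ)) y‖ ^ 2
        = ∑ κ, ∑ μ, VariationalColourBochner.nsqv N (DirAdjv N R μ (Dirv N R κ (fun z => W z μ))) := by
          rw [Finset.sum_comm]
          refine sum_congr rfl fun κ _ => ?_
          rw [Finset.sum_comm]
          rfl
      _ = ∑ κ, ∑ μ, VariationalColourBochner.nsqv N (Dirv N R μ (Dirv N R κ (fun z => W z μ))) :=
          sum_congr rfl fun κ _ => sum_congr rfl fun μ _ => nsqv_DirAdjv_eq N hU μ _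
      _ ≤ hessV N R W := sum_nsqv_Dirv_Dirv_le_hessV N R W
  have hB : ∑ y, ∑ κ, ∑ μ, ‖W (y - unitVec N μ + unitVec N κ) μ‖ ^ 2 = d * nsqV N W := by
    calc ∑ y, ∑ κ, ∑ μ, ‖W (y - unitVec N μ + unitVec N κ) μ‖ ^ 2
        = ∑ κ, ∑ μ, ∑ y, ‖W (y - unitVec N μ + unitVec N κ) μ‖ ^ 2 := by
          rw [Finset.sum_comm]; exact sum_congr rfl fun κ _ => Finset.sum_comm
      _ = ∑ κ : Fin d, ∑ μ, ∑ y, ‖W y μ‖ ^ 2 := by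
          refine sum_congr rfl fun κ _ => sum_congr rfl fun μ _ => ?_
          have := sum_sq_translate N (fun y => W y μ) (-unitVec N μ + unitVec N κ)
          rw [← this]
          exact sum_congr rfl fun x _ => by rw [← add_assoc, ← sub_eq_add_neg]
      _ = d * nsqV N W := by rw [sum_const, card_univ, Fintype.card_fin, nsmul_eq_mul, nsqV_eq_sum_nsqv]
  calc ∑ y, ∑ κ, ‖cDv N R (divV N R W) y κ‖ ^ 2
      ≤ ∑ y, ∑ κ, (2 * d * ∑ μ, ‖DirAdjv N R μ (Dirv N R κ (fun z => W z μ)) y‖ ^ 2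
          + 2 * d * p ^ 2 * ∑ μ, ‖W (y - unitVec N μ + unitVec N κ) μ‖ ^ 2) := sum_le_sum fun y _ => sum_le_sum fun κ _ => hpt y κ
    _ = 2 * d * ∑ y, ∑ κ, ∑ μ, ‖DirAdjv N R μ (Dirv N R κ (fun z => W z μ)) y‖ ^ 2
          + 2 * d * p ^ 2 * ∑ y, ∑ κ, ∑ μ, ‖W (y - unitVec N μ + unitVec N κ) μ‖ ^ 2 := by
        simp only [sum_add_distrib, mul_sum]
    _ ≤ 2 * d * hessV N R W + 2 * d * p ^ 2 * (d * nsqV N W) := by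
        rw [hB]; exact add_le_add (mul_le_mul_of_nonneg_left hA (by positivity)) le_rfl
    _ = _ := by ring

end DivGrad

/-! ## §3 The harmonic part of a 0-form: gradient below `Λ·n⁻²·‖·‖²` (scalar UB + minimality + Jensen) -/

section Harmonic

variable (n : ℕ) [NeZero n] (M : Fin d → ℕ) [hM : ∀ μ, NeZero (M μ)] [FiniteDimensional ℂ E]

/-- **THE HARMONIC PART HAS SMALL GRADIENT**: `T` contractive site frames, `R` any bond transports, the scalar UB leaf `hUBc` with constant `Λ`; for ANY
0-form `v` the orthogonal representative `s₀ := Π_{(S_R(ker Q_T))ᗮ} v` (a scalar fibre-minimiser, `isMin_starProjection_orthogonal`) satisfies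
`Σ_μ dirUv R s₀ μ ≤ Λ·(n²)⁻¹·Σ_x ‖v x‖²`. [folklore] -/
theorem sum_dirUv_harmonicPart_le {T : Tor (fine n M) → (E →L[ℂ] E)} (hT : ∀ x, ‖T x‖ ≤ 1) (R : Tor (fine n M) → Fin d → (E →L[ℂ] E))
    {Λ : ℝ} (hΛ : 0 ≤ Λ) (hUBc : ∀ ψ : Tor M → E, ∃ f, Qkv n M T f = ψ ∧ Scv n M R f ≤ Λ * nsqv ψ) (v : Tor (fine n M) → E) :
    ∑ μ, dirUv (fine n M) R (WithLp.ofLp ((sliceSub (fine n M) R (LinearMap.ker (avgOp n M T)))ᗮ.starProjection (toLp 2 v))) μ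
      ≤ Λ * ((n : ℝ) ^ 2)⁻¹ * ∑ x, ‖v x‖ ^ 2 := by
  set s₀ : Tor (fine n M) → E := WithLp.ofLp ((sliceSub (fine n M) R (LinearMap.ker (avgOp n M T)))ᗮ.starProjection (toLp 2 v)) with hs₀
  have hn : (0 : ℝ) < n := by exact_mod_cast Nat.pos_of_ne_zero (NeZero.ne n)
  have hnd : (0 : ℝ) < (n : ℝ) ^ d := by positivity
  -- the UB competitor in the fibre of `s₀`, and minimality of `s₀`
  obtain ⟨f, hf, hSc⟩ := hUBc (Qkv n M T s₀)
  have hmin : ∑ μ, dirUv (fine n M) R s₀ μ ≤ ∑ μ, dirUv (fine n M) R f μ :=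
    isMin_starProjection_orthogonal n M T R (toLp 2 v) f (by
      have : Qkv n M T f = Qkv n M T s₀ := hf
      exact funext fun z => congrFun this z)
  -- `Scv f ≤ Λ·nsqv (Q_T s₀) ≤ Λ·n^{−d}·nsqv s₀`
  have hJ : nsqv (Qkv n M T s₀) ≤ ((n : ℝ) ^ d)⁻¹ * ∑ x, ‖s₀ x‖ ^ 2 := sum_norm_sq_Qcv_le n M hT s₀
  have h1 : (n : ℝ) ^ 2 / (n : ℝ) ^ d * ∑ μ, dirUv (fine n M) R s₀ μ ≤ Λ * (((n : ℝ) ^ d)⁻¹ * ∑ x, ‖s₀ x‖ ^ 2) := by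
    calc (n : ℝ) ^ 2 / (n : ℝ) ^ d * ∑ μ, dirUv (fine n M) R s₀ μ ≤ (n : ℝ) ^ 2 / (n : ℝ) ^ d * ∑ μ, dirUv (fine n M) R f μ :=
          mul_le_mul_of_nonneg_left hmin (by positivity)
      _ = Scv n M R f := rfl
      _ ≤ Λ * nsqv (Qkv n M T s₀) := hSc
      _ ≤ _ := mul_le_mul_of_nonneg_left hJ hΛ
  -- `‖s₀‖ ≤ ‖v‖`
  have h2 : ∑ x, ‖s₀ x‖ ^ 2 ≤ ∑ x, ‖v x‖ ^ 2 := by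
    rw [← norm_toLp_sq (fine n M) v, ← norm_toLp_sq (fine n M) s₀, hs₀, WithLp.toLp_ofLp]
    exact pow_le_pow_left₀ (norm_nonneg _) (Submodule.norm_starProjection_apply_le _ _) 2
  -- divide by `n²∕n^d`
  have h3 : ∑ μ, dirUv (fine n M) R s₀ μ ≤ Λ * ((n : ℝ) ^ 2)⁻¹ * ∑ x, ‖s₀ x‖ ^ 2 := by
    have hc : (0 : ℝ) < (n : ℝ) ^ 2 / (n : ℝ) ^ d := by positivity
    refine le_of_mul_le_mul_left (h1.trans_eq ?_) hc
    field_simp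
  exact h3.trans (mul_le_mul_of_nonneg_left h2 (by positivity))

omit [CompleteSpace E] [FiniteDimensional ℂ E] in
/-- `Σ_y Σ_μ ‖cDv f y μ‖² = Σ_μ dirUv f μ`. [folklore] -/
theorem sum_sum_cDv_sq_eq (R : Tor (fine n M) → Fin d → (E →L[ℂ] E)) (f : Tor (fine n M) → E) :
    ∑ y, ∑ μ, ‖cDv (fine n M) R f y μ‖ ^ 2 = ∑ μ, dirUv (fine n M) R f μ := by
  rw [Finset.sum_comm]; rfl

/-- **THE `S0` SUMMAND OF `oneG_centred_le`**: UNITARY bond transports with plaquette defect `≤ p`, contractive site frames `T`, the scalar UB leaf (`Λ`):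
`Σ_{y,μ} ‖D_μ(div_R W − s₀)(y)‖² ≤ 2·(2d·hessV R W + 2d²p²·nsqV W) + 2·Λ·(n²)⁻¹·divSq R W`, `s₀ := Π_{(S_R(ker Q_T))ᗮ}(div_R W)`. [folklore] -/
theorem sum_cDv_sub_harmonicPart_sq_le {R : Tor (fine n M) → Fin d → (E →L[ℂ] E)} (hU : ∀ x μ, R x μ ∈ unitary (E →L[ℂ] E))
    {p : ℝ} (hp : 0 ≤ p) (hP : ∀ x μ ν, ‖R x μ * R (x + unitVec (fine n M) μ) ν - R x ν * R (x + unitVec (fine n M) ν) μ‖ ≤ p)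
    {T : Tor (fine n M) → (E →L[ℂ] E)} (hT : ∀ x, ‖T x‖ ≤ 1)
    {Λ : ℝ} (hΛ : 0 ≤ Λ) (hUBc : ∀ ψ : Tor M → E, ∃ f, Qkv n M T f = ψ ∧ Scv n M R f ≤ Λ * nsqv ψ) (W : Tor (fine n M) → Fin d → E) :
    ∑ y, ∑ μ, ‖cDv (fine n M) R (divV (fine n M) R W
        - WithLp.ofLp ((sliceSub (fine n M) R (LinearMap.ker (avgOp n M T)))ᗮ.starProjection (toLp 2 (divV (fine n M) R W)))) y μ‖ ^ 2
      ≤ 2 * (2 * d * hessV (fine n M) R W + 2 * (d : ℝ) ^ 2 * p ^ 2 * nsqV (fine n M) W) + 2 * (Λ * ((n : ℝ) ^ 2)⁻¹ * divSq (fine n M) R W) := by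
  set s₀ : Tor (fine n M) → E :=
    WithLp.ofLp ((sliceSub (fine n M) R (LinearMap.ker (avgOp n M T)))ᗮ.starProjection (toLp 2 (divV (fine n M) R W))) with hs₀
  have hsplit : ∀ y μ, ‖cDv (fine n M) R (divV (fine n M) R W - s₀) y μ‖ ^ 2
      ≤ 2 * ‖cDv (fine n M) R (divV (fine n M) R W) y μ‖ ^ 2 + 2 * ‖cDv (fine n M) R s₀ y μ‖ ^ 2 := by
    intro y μ
    have e : cDv (fine n M) R (divV (fine n M) R W - s₀) y μ = cDv (fine n M) R (divV (fine n M) R W) y μ - cDv (fine n M) R s₀ y μ :=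
      cDv_sub (fine n M) R (divV (fine n M) R W) s₀ y μ
    rw [e]; exact norm_sub_sq_le_two _ _
  have hH := sum_cDv_divV_sq_le (fine n M) hU hp hP W
  have hS : ∑ y, ∑ μ, ‖cDv (fine n M) R s₀ y μ‖ ^ 2 ≤ Λ * ((n : ℝ) ^ 2)⁻¹ * divSq (fine n M) R W := by
    rw [sum_sum_cDv_sq_eq, hs₀]
    exact sum_dirUv_harmonicPart_le n M hT R hΛ hUBc (divV (fine n M) R W)
  calc ∑ y, ∑ μ, ‖cDv (fine n M) R (divV (fine n M) R W - s₀) y μ‖ ^ 2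
      ≤ ∑ y, ∑ μ, (2 * ‖cDv (fine n M) R (divV (fine n M) R W) y μ‖ ^ 2 + 2 * ‖cDv (fine n M) R s₀ y μ‖ ^ 2) :=
        sum_le_sum fun y _ => sum_le_sum fun μ _ => hsplit y μ
    _ = 2 * ∑ y, ∑ μ, ‖cDv (fine n M) R (divV (fine n M) R W) y μ‖ ^ 2 + 2 * ∑ y, ∑ μ, ‖cDv (fine n M) R s₀ y μ‖ ^ 2 := by
        simp only [sum_add_distrib, mul_sum]
    _ ≤ _ := add_le_add (mul_le_mul_of_nonneg_left hH (by norm_num)) (mul_le_mul_of_nonneg_left hS (by norm_num))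

end Harmonic

/-! ## §4 The arithmetic skeleton of file B's assembly (pure real inequality) -/

section Abstract

/-- **THE ARITHMETIC OF THE ASSEMBLY** (pure real inequality): gen 8's `ρ̃` as a polynomial in the raw sizes, the budgets `size ≤ coefficient·A`, the three
normalisation identities `cf·L^d∕L² = cc`, `cf·L^{d−1} = cc·L`, `cf·L^d = cc·L²` and `(√(d∕4))² = d∕4` give `ρ̃ ≤ ε⋆·A`. [folklore] -/
theorem rhoTilde_abstract_le
    {u s t c₁ d L m₁ p CP eH Λv Λ n2 n2inv ndinv cc cf Ld2 Lp Ld r S S0v ρ Gw H DIAG DIAG' NSQ DDIV S0 DV A CRv CPv Cg Cdv : ℝ}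
    (hu : 0 < u) (hs : 0 < s) (ht : 0 < t) (hc₁ : 0 ≤ c₁) (hd : 0 ≤ d) (hL : 0 ≤ L) (hm₁ : 0 ≤ m₁) (hCP : 0 ≤ CP) (heH : 0 ≤ eH)
    (hΛv : 0 ≤ Λv)
    (hS : S ≤ A) (hS0v : S0v ≤ A) (hρ : ρ ≤ CRv * A) (hG : cc * Gw ≤ A)
    (b1 : cc * H ≤ n2inv * (CRv * A)) (b2 : cc * NSQ ≤ n2 * (CPv * A)) (b3 : cc * DIAG ≤ Cg * A) (b3' : ndinv * DIAG' ≤ n2inv * (Cg * A))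
    (b4 : cc * DV ≤ Cdv * A)
    (b5 : cc * DDIV ≤ 2 * d * (n2inv * (CRv * A)) + 2 * d ^ 2 * p ^ 2 * (n2 * (CPv * A)))
    (b6 : cc * S0 ≤ 2 * (2 * d * (n2inv * (CRv * A)) + 2 * d ^ 2 * p ^ 2 * (n2 * (CPv * A))) + 2 * (Λ * n2inv * (Cdv * A)))
    (f1 : cf * Ld2 = cc) (f2 : cf * Lp = cc * L) (f3 : cf * Ld = cc * L ^ 2) (hr : r = d / 4) :
    u * S + (1 + u) * ((s + (1 + s⁻¹) * c₁) * (S0v + ρ)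
        + (t * (cc * Gw) + 3 * (1 + t⁻¹) * (cf * (8 * d * (Ld2 * H + (1 + m₁) ^ 2 * (Lp * (d / 4 * H)) + m₁ ^ 2 * (Ld2 * DIAG)
            + m₁ ^ 2 * (2 * (1 + d ^ 2) * (Ld * NSQ))) + d / 2 * (Ld2 * DDIV)) + r * (cc * S0) + CP * eH * (cc * DV))))
      + (1 + u⁻¹) * (Λv * (25 / 4 * (ndinv * DIAG')))
      ≤ (u + (1 + u) * ((s + (1 + s⁻¹) * c₁) * (1 + CRv) + (t + 3 * (1 + t⁻¹) * (8 * d * (n2inv * CRv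
            + (1 + m₁) ^ 2 * (d / 4 * L * (n2inv * CRv)) + m₁ ^ 2 * Cg + m₁ ^ 2 * (2 * (1 + d ^ 2) * L ^ 2 * (n2 * CPv)))
          + d / 2 * (2 * d * (n2inv * CRv) + 2 * d ^ 2 * p ^ 2 * (n2 * CPv))
          + d / 4 * (2 * (2 * d * (n2inv * CRv) + 2 * d ^ 2 * p ^ 2 * (n2 * CPv)) + 2 * (Λ * n2inv * Cdv)) + CP * eH * Cdv)))
        + (1 + u⁻¹) * (Λv * (25 / 4 * (n2inv * Cg)))) * A := by
  -- the `cf`-block in `cc`-currency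
  have hX : cf * (8 * d * (Ld2 * H + (1 + m₁) ^ 2 * (Lp * (d / 4 * H)) + m₁ ^ 2 * (Ld2 * DIAG) + m₁ ^ 2 * (2 * (1 + d ^ 2) * (Ld * NSQ)))
        + d / 2 * (Ld2 * DDIV))
      = 8 * d * (cc * H + (1 + m₁) ^ 2 * (d / 4 * L * (cc * H)) + m₁ ^ 2 * (cc * DIAG) + m₁ ^ 2 * (2 * (1 + d ^ 2) * L ^ 2 * (cc * NSQ)))
        + d / 2 * (cc * DDIV) := by
    linear_combination (8 * d * H + 8 * d * m₁ ^ 2 * DIAG + d / 2 * DDIV) * f1 + (8 * d * ((1 + m₁) ^ 2 * (d / 4 * H))) * f2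
      + (8 * d * (m₁ ^ 2 * (2 * (1 + d ^ 2) * NSQ))) * f3
  rw [hX, hr]
  have hsc : 0 ≤ s + (1 + s⁻¹) * c₁ := by positivity
  have hu1 : 0 ≤ 1 + u := by positivity
  have p0 := mul_le_mul_of_nonneg_left hS hu.le
  have p1 := mul_le_mul_of_nonneg_left (add_le_add hS0v hρ) (mul_nonneg hu1 hsc)
  have p2 := mul_le_mul_of_nonneg_left hG (mul_nonneg hu1 ht.le)
  have p3 := mul_le_mul_of_nonneg_left b1 (by positivity : 0 ≤ (1 + u) * (3 * (1 + t⁻¹)) * (8 * d) * (1 + (1 + m₁) ^ 2 * (d / 4 * L)))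
  have p4 := mul_le_mul_of_nonneg_left b3 (by positivity : 0 ≤ (1 + u) * (3 * (1 + t⁻¹)) * (8 * d) * m₁ ^ 2)
  have p5 := mul_le_mul_of_nonneg_left b2 (by positivity : 0 ≤ (1 + u) * (3 * (1 + t⁻¹)) * (8 * d) * (m₁ ^ 2 * (2 * (1 + d ^ 2) * L ^ 2)))
  have p6 := mul_le_mul_of_nonneg_left b5 (by positivity : 0 ≤ (1 + u) * (3 * (1 + t⁻¹)) * (d / 2))
  have p7 := mul_le_mul_of_nonneg_left b6 (by positivity : 0 ≤ (1 + u) * (3 * (1 + t⁻¹)) * (d / 4))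
  have p8 := mul_le_mul_of_nonneg_left b4 (by positivity : 0 ≤ (1 + u) * (3 * (1 + t⁻¹)) * (CP * eH))
  have p9 := mul_le_mul_of_nonneg_left b3' (by positivity : 0 ≤ (1 + u⁻¹) * (Λv * (25 / 4)))
  linarith [p0, p1, p2, p3, p4, p5, p6, p7, p8, p9]

end Abstract

end Summit.QuantumFields.BalabanUV.T4Continuum.VariationalVectorDivHessian

end
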